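import Literature.Analysis.FluidPDE.Onsager
import Literature.Analysis.FunctionSpaces.TorusConvolution
import Literature.Analysis.FunctionSpaces.DuBoisReymondAE
import Mathlib.Analysis.Normed.Lp.MeasurableSpace
import HarnessLib

/-!
# Sharp Onsager rigidity on `T^d` (CCFS 2008, Thm 3.3): the Constantin–E–Titi flux and the reduction

Analysis/FluidPDE support file for the discharge of the named fact
`Literature.Analysis.FluidPDE.onsager_rigidity_ccfs` (`Literature/Analysis/FluidPDE/Onsager`):
Cheskidov–Constantin–Friedlander–Shvydkoy, *Energy conservation and Onsager's conjecture for the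
Euler equations*, Nonlinearity 21 (2008) = arXiv:0704.0759, Thm 3.3 — every weak Euler solution
of class `L³(0,T; B^{1/3}_{3,c(ℕ)})` conserves energy — in the tree's transcription (flat torus
`T³`, `L²_{t,x}` weak solutions `Torus.IsWeakEulerSolutionOn`, the difference-quotient vanishing
class `B^{1/3}_{3,c₀} ⊂ B^{1/3}_{3,c(ℕ)}`, conservation a.e. in time).

The printed proof (CCFS §3.2, which is the Constantin–E–Titi 1994 commutator argument with a
sharper bookkeeping) has the following architecture, each step of which is recorded here either
as a **proved** statement or as a **named fact** (`def … : Prop`, D-0014) to be discharged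
bottom-up; the physical-space mollifier `K_ε = Torus.kernel ε` replaces the Littlewood–Paley
truncation `S_Q` throughout (CET's original setting):

* (11) *mollified energy balance*: testing the weak formulation with `ψ = S_Q² u` gives
  `Π_Q(t) = ½ d/dt ‖S_Q u(t)‖₂²` — named fact `Torus.IsWeakEulerSolutionOn.energyBalance_vecConv`
  (in `𝒟'(0,T)`, for `u ∈ L³_{t,x}`);
* (14)–(18) *the CET flux estimate* `|Π_Q| ≤ C (K ∗ d²)^{3/2}(Q)`, whose mollifier form is
  `|Π_{K_ε}[v]| ≤ C ω(v; ε)³` with the local difference modulus `ω` — named fact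
  `Torus.abs_cetFlux_le_eLocDiffModulus`;
* (13) + Thm 3.3 *the total flux vanishes* in `L³_t B^{1/3}_{3,c₀}` — named fact
  `Torus.tendsto_lintegral_cetFlux` (dominated convergence in time);
* *`‖S_Q u(t)‖₂ → ‖u(t)‖₂`* (implicit in CCFS; Evans, App. C.4, Thm 7 (iv)) — named fact
  `Torus.tendsto_lintegral_kineticEnergy_vecConv_sub`;
* *assembly* (proved here): `∫₀ᵀ θ' E(u(t)) dt = 0` for all `θ ∈ C_c^∞(0,T)`
  (`Turb.setIntegral_deriv_mul_energyProfile_eq_zero`); the du Bois-Reymond lemma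
  (the accepted `Literature.Analysis.FunctionSpaces.ae_eq_const_of_forall_setIntegral_deriv_mul_eq_zero`,
  `FunctionSpaces/DistributionalConstancy`, Brezis 2011, Lemma 8.1) then makes the energy a.e.
  constant — that last, one-line step `Turb.onsager_rigidity_ccfs_of : F₁ → F₃ → F₄ →
  onsager_rigidity_ccfs` is kept in the sibling file `OnsagerCCFSReduction` (import hygiene).
  Since the tree reduces the Constantin–E–Titi form to the sharp one
  (`Turb.onsager_rigidity_of_ccfs`), discharging the three named facts proves both
  `Turb.onsager_rigidity_ccfs` and `Turb.onsager_rigidity`.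

## Contents

* `Literature.eLocDiffModulus s p f μ ℓ = sup_{0 < ‖h‖ ≤ ℓ} ‖f(· + h) - f‖_{L^p} / ‖h‖^s`, the local
  difference modulus, with `eLocDiffModulus_le_eBesovSupSeminorm`, monotonicity, and
  `MemBesovSupVanishing.tendsto_eLocDiffModulus` (`ω(f; ℓ) → 0` as `ℓ → 0⁺` in `B^s_{p,c₀}`);
* `Torus.vecConv v K` (componentwise mollification of a vector field by a real kernel, Mathlib's
  group convolution on `T^d`) and `Torus.cetFlux K v = ∫ ∑ᵢⱼ ((vᵢvⱼ) ⋆ K) ∂ᵢ(vⱼ ⋆ K)`, the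
  Constantin–E–Titi energy flux through the kernel `K` (CCFS (10) in physical space);
* the four named facts above;
* glue, all proved: `L³_t B^s_{3,∞} ⊂ L³_{t,x}`
  (`Torus.lintegral_lintegral_enorm_pow_three_lt_top_of_memLpBesovSup`), integrability in time
  of the kinetic energy of an `L²_{t,x}` field (`Torus.integrableOn_kineticEnergy`), joint
  measurability of mollified fields (`Torus.aestronglyMeasurable_uncurry_vecConv`), and the
  reduction theorems.

## Design choices

* General `d` (`[Fintype d] [DecidableEq d]`) for the objects and facts — the argument is
  dimension-free — specialised to `Fin 3` only in the reduction, where `Turb.onsager_rigidity_ccfs`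
  lives.
* Time integrals in the convergence facts are *lower Lebesgue integrals* (`∫⁻ … ‖·‖ₑ`), so that
  the facts presuppose no integrability; the class `MemLpBesovSupVanishing` does not record
  measurability in time of the Besov norm, and the proofs are arranged so that none is needed
  (a.e. inequalities and `lintegral` monotonicity only; the dominated convergence theorem for
  `lintegral` along `𝓝[>] 0`, Mathlib's `tendsto_lintegral_filter_of_dominated_convergence'`,
  allows a non-measurable bound).
* The mollifier is the fixed `Torus.kernel ε` (`0 < ε ≤ 1/4`, `TorusMollifier`); all
  convolutions are Mathlib's `⋆[lsmul ℝ ℝ, volume]` on the compact abelian group `T^d`, real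
  scalar functions against real kernels, vector fields componentwise (`vecConv`), so that the
  accepted `TorusConvolution` API (smoothness, `∂ᵢ(θ ⋆ k) = θ ⋆ ∂ᵢk`, Young, `L²` convergence,
  joint measurability) applies verbatim.

## Mathlib search

Mathlib (this pin) has group convolution (`MeasureTheory.convolution`), `eLpNorm`/`MemLp`,
dominated convergence for `lintegral` along filters, `tendsto_nhds_unique`,
`norm_integral_le_lintegral_norm`; it has no Besov classes, no Euler equations, no energy flux
(searched `Besov`, `Onsager`, `energy flux`, `commutator estimate` — none). The tree supplies the
torus calculus, the mollifier and the Besov difference classes.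

## References

* A. Cheskidov, P. Constantin, S. Friedlander, R. Shvydkoy, *Energy conservation and Onsager's
  conjecture for the Euler equations*, Nonlinearity 21 (2008) 1233–1252 = arXiv:0704.0759, §3.1
  Def. 3.1, §3.2 (10)–(18), Prop. 3.2, Thm 3.3 (numbering of the arXiv version, the one held and
  read: pp. 5–6 of the PDF). [CCFS2008]
* P. Constantin, W. E, E. S. Titi, *Onsager's conjecture on the energy conservation for solutions
  of Euler's equation*, Comm. Math. Phys. 165 (1994), 207–209, (3)–(6). [ConstantinETiti1994]
* L. C. Evans, *Partial Differential Equations*, 2nd ed. (AMS 2010), App. C.4, Thm 7. [Evans2010]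
* H. Brezis, *Functional Analysis, Sobolev Spaces and PDE* (Springer 2011), Lemma 8.1. [Brezis2011]
-/

noncomputable section

open MeasureTheory TopologicalSpace Set Function Filter Topology Metric
open scoped ENNReal NNReal Convolution ContDiff InnerProductSpace

namespace Literature.Analysis.FluidPDE

/-! ## The local Besov difference modulus -/

section LocMod

variable {G : Type*} {F : Type*} [NormedAddCommGroup G] [MeasurableSpace G] [NormedAddCommGroup F]

/-- The **local difference modulus** of order `s` in `L^p`:
`ω_{s,p}(f; ℓ) = sup {‖f(· + h) - f‖_{L^p(μ)} / ‖h‖^s : 0 < ‖h‖ ≤ ℓ}` — the supremum of the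
difference quotients `eDiffQuotient s p f μ h` over the nonzero increments of norm at most `ℓ`
(the quantity whose vanishing as `ℓ → 0` defines the class `B^s_{p,c₀}`,
Cheskidov–Constantin–Friedlander–Shvydkoy 2008, §3.2 (13) in difference form; cf.
`Literature.Analysis.FunctionSpaces.MemBesovSupVanishing`). For `ℓ < 0` the supremum is empty and the modulus is `0`. [folklore] -/
def eLocDiffModulus (s : ℝ) (p : ℝ≥0∞) (f : G → F) (μ : Measure G) (ℓ : ℝ) : ℝ≥0∞ :=
  ⨆ (h : G) (_ : h ≠ 0) (_ : ‖h‖ ≤ ℓ), FunctionSpaces.eDiffQuotient s p f μ h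

variable {s : ℝ} {p : ℝ≥0∞} {f : G → F} {μ : Measure G}

/-- Unfolding lemma for `eLocDiffModulus`. [folklore] -/
theorem eLocDiffModulus_def (ℓ : ℝ) : eLocDiffModulus s p f μ ℓ =
    ⨆ (h : G) (_ : h ≠ 0) (_ : ‖h‖ ≤ ℓ), FunctionSpaces.eDiffQuotient s p f μ h := rfl

/-- Each difference quotient at an increment `0 < ‖h‖ ≤ ℓ` is bounded by the local modulus. [folklore] -/
theorem eDiffQuotient_le_eLocDiffModulus {ℓ : ℝ} {h : G} (hh : h ≠ 0) (hℓ : ‖h‖ ≤ ℓ) :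
    FunctionSpaces.eDiffQuotient s p f μ h ≤ eLocDiffModulus s p f μ ℓ :=
  le_iSup_of_le (f := fun h : G => ⨆ (_ : h ≠ 0) (_ : ‖h‖ ≤ ℓ), FunctionSpaces.eDiffQuotient s p f μ h) h
    (le_iSup_of_le (f := fun _ : h ≠ 0 => ⨆ (_ : ‖h‖ ≤ ℓ), FunctionSpaces.eDiffQuotient s p f μ h) hh
      (le_iSup (f := fun _ : ‖h‖ ≤ ℓ => FunctionSpaces.eDiffQuotient s p f μ h) hℓ))

/-- The defining estimate: `‖f(· + h) - f‖_{L^p} ≤ ω(f; ℓ) ‖h‖^s` for `0 < ‖h‖ ≤ ℓ`. [folklore] -/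
theorem eLpNorm_sub_le_eLocDiffModulus_mul {ℓ : ℝ} {h : G} (hh : h ≠ 0) (hℓ : ‖h‖ ≤ ℓ) :
    eLpNorm (fun x => f (x + h) - f x) p μ ≤
      eLocDiffModulus s p f μ ℓ * ENNReal.ofReal (‖h‖ ^ s) := by
  have := eDiffQuotient_le_eLocDiffModulus (s := s) (p := p) (f := f) (μ := μ) hh hℓ
  rw [FunctionSpaces.eDiffQuotient_def, ENNReal.div_le_iff (FunctionSpaces.ofReal_norm_rpow_pos s hh).ne' ENNReal.ofReal_ne_top]
    at this
  exact this

/-- The local modulus is bounded by the global Besov seminorm: `ω(f; ℓ) ≤ [f]_{B^s_{p,∞}}`. [folklore] -/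
theorem eLocDiffModulus_le_eBesovSupSeminorm (ℓ : ℝ) :
    eLocDiffModulus s p f μ ℓ ≤ FunctionSpaces.eBesovSupSeminorm s p f μ :=
  iSup_le fun _ => iSup_le fun hh => iSup_le fun _ => FunctionSpaces.eDiffQuotient_le_eBesovSupSeminorm hh

/-- The local modulus is monotone in the scale `ℓ`. [folklore] -/
theorem eLocDiffModulus_mono {ℓ ℓ' : ℝ} (hℓ : ℓ ≤ ℓ') :
    eLocDiffModulus s p f μ ℓ ≤ eLocDiffModulus s p f μ ℓ' :=
  iSup_le fun _ => iSup_le fun hh => iSup_le fun hℓh =>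
    eDiffQuotient_le_eLocDiffModulus hh (hℓh.trans hℓ)

/-- At negative scales the supremum is empty: `ω(f; ℓ) = 0` for `ℓ < 0`. [folklore] -/
theorem eLocDiffModulus_of_neg {ℓ : ℝ} (hℓ : ℓ < 0) : eLocDiffModulus s p f μ ℓ = 0 := by
  refine le_antisymm (iSup_le fun h => iSup_le fun _ => iSup_le fun hℓh => ?_) bot_le
  exact absurd (hℓh.trans_lt hℓ) (not_lt.2 (norm_nonneg h))

/-- The local modulus of the zero function vanishes. [folklore] -/
@[simp]
theorem eLocDiffModulus_zero (ℓ : ℝ) : eLocDiffModulus s p (0 : G → F) μ ℓ = 0 := by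
  refine le_antisymm ?_ bot_le
  refine (eLocDiffModulus_le_eBesovSupSeminorm ℓ).trans ?_
  rw [FunctionSpaces.eBesovSupSeminorm_zero]

/-- **The vanishing class in terms of the local modulus.** For `f ∈ B^s_{p,c₀}(μ)` the local
modulus tends to `0` with the scale: `ω(f; ℓ) → 0` as `ℓ → 0⁺` (the difference quotient tends to
`0` along `h → 0`, `h ≠ 0`, so it is eventually `≤ η` on a punctured ball `0 < ‖h‖ < δ`, whence
`ω(f; ℓ) ≤ η` for `0 < ℓ < δ`). [folklore] -/
theorem _root_.Literature.Analysis.FunctionSpaces.MemBesovSupVanishing.tendsto_eLocDiffModulus (hf : FunctionSpaces.MemBesovSupVanishing s p f μ) :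
    Tendsto (eLocDiffModulus s p f μ) (𝓝[>] 0) (𝓝 0) := by
  rw [ENNReal.tendsto_nhds_zero]
  intro η hη
  have h := hf.tendsto
  rw [ENNReal.tendsto_nhds_zero] at h
  have h' := h η hη
  rw [eventually_nhdsWithin_iff, Metric.eventually_nhds_iff] at h'
  obtain ⟨δ, hδ, hball⟩ := h'
  have hmem : Ioo (0 : ℝ) δ ∈ 𝓝[>] (0 : ℝ) := Ioo_mem_nhdsGT hδ
  filter_upwards [hmem] with ℓ hℓ
  refine iSup_le fun k => iSup_le fun hk => iSup_le fun hkℓ => ?_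
  have hk' : dist k 0 < δ := by
    rw [dist_zero_right]
    exact hkℓ.trans_lt hℓ.2
  simpa using hball hk' hk

end LocMod

namespace Torus

variable {d : Type*} [Fintype d] [DecidableEq d]

/-! ## Mollified vector fields and the Constantin–E–Titi energy flux -/

section Flux

/-- **Componentwise mollification of a vector field** on `T^d` by a real kernel `K`:
`(v ⋆ K)(x) = (∫ vᵢ(y) K(x - y) dy)ᵢ`, each component being Mathlib's group convolution
`(vᵢ ⋆[lsmul ℝ ℝ] K)(x)` on the compact abelian group `T^d` (Evans, App. C.4; on `T^d`:
`Literature.Analysis.FunctionSpaces.TorusConvolution`). Junk: at points where the integrand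
is not integrable the Bochner integral is `0` (never the case for `v ∈ L¹`, `K` continuous). [folklore] -/
def vecConv (v : UnitAddTorus d → EuclideanSpace ℝ d) (K : UnitAddTorus d → ℝ) :
    UnitAddTorus d → EuclideanSpace ℝ d :=
  fun x => WithLp.toLp 2 fun i => ((fun y => v y i) ⋆ K) x

omit [DecidableEq d] in
/-- Components of the mollified field: `(vecConv v K x) i = (vᵢ ⋆ K)(x)`. [folklore] -/
@[simp]
theorem vecConv_apply (v : UnitAddTorus d → EuclideanSpace ℝ d) (K : UnitAddTorus d → ℝ)
    (x : UnitAddTorus d) (i : d) : vecConv v K x i = ((fun y => v y i) ⋆ K) x := rfl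

omit [DecidableEq d] in
/-- The mollification of the zero field is zero. [folklore] -/
@[simp]
theorem vecConv_zero (K : UnitAddTorus d → ℝ) :
    vecConv (0 : UnitAddTorus d → EuclideanSpace ℝ d) K = 0 := by
  funext x
  ext i
  have h0 : (fun y => (0 : UnitAddTorus d → EuclideanSpace ℝ d) y i) = 0 := by
    funext y
    simp
  rw [vecConv_apply, h0, zero_convolution]
  simp

/-- **The Constantin–E–Titi energy flux through the kernel `K`** of a velocity field
`v : T^d → ℝ^d`:
`Π_K[v] = ∫_{T^d} ∑ᵢ ∑ⱼ ((vᵢ vⱼ) ⋆ K)(x) · ∂ᵢ (vⱼ ⋆ K)(x) dx = ∫ tr[(v ⊗ v)_K · ∇ v_K]`,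
the physical-space (mollifier) form of the Littlewood–Paley flux
`Π_Q = ∫ tr[S_Q(u ⊗ u) · ∇ S_Q u] dx` of Cheskidov–Constantin–Friedlander–Shvydkoy 2008, §3.2,
eq. (10), with the Fourier truncation `S_Q` replaced by mollification `· ⋆ K`
(Constantin–E–Titi 1994, p. 208: the same expression with a standard mollifier `φ^ε`). For a
weak Euler solution it is the time derivative of the mollified kinetic energy,
`Π_K[u(t)] = d/dt ½‖u(t) ⋆ K‖₂²` in `𝒟'(0,T)` (CCFS (11); here the named fact
`IsWeakEulerSolutionOn.energyBalance_vecConv`). Bochner integral; for `v ∈ L³` and smooth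
`K` the integrand is continuous, so no junk value occurs. [cite: CCFS2008, §3.2 eq. (10)] -/
def cetFlux (K : UnitAddTorus d → ℝ) (v : UnitAddTorus d → EuclideanSpace ℝ d) : ℝ :=
  ∫ x, ∑ i, ∑ j, ((fun y => v y i * v y j) ⋆ K) x * FunctionSpaces.Torus.partialDeriv i ((fun y => v y j) ⋆ K) x

/-- The flux of the zero field vanishes. [folklore] -/
@[simp]
theorem cetFlux_zero (K : UnitAddTorus d → ℝ) :
    cetFlux K (0 : UnitAddTorus d → EuclideanSpace ℝ d) = 0 := by
  unfold cetFlux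
  have h0 : ∀ i j : d, (fun y => (0 : UnitAddTorus d → EuclideanSpace ℝ d) y i *
      (0 : UnitAddTorus d → EuclideanSpace ℝ d) y j) = 0 := fun i j => by
    funext y
    simp
  simp_rw [h0, zero_convolution, Pi.zero_apply, zero_mul, Finset.sum_const_zero, integral_zero]

end Flux

/-! ## The named facts of the decomposition (CCFS 2008, proof of Thm 3.3) -/

section Facts

/-- **Mollified energy balance** (step (11) of Cheskidov–Constantin–Friedlander–Shvydkoy 2008,
§3.2: "If `u(t)` is a weak solution to the Euler equation, then substituting the test function
`ψ = S_Q² u` into the weak formulation of the Euler equation (7) we obtain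
`Π_Q(t) = ½ d/dt ‖S_Q u(t)‖₂²`"; Constantin–E–Titi 1994, p. 208, the same with a mollifier).
Transcription: on `T^d`, for a weak Euler solution `u` on `(0,T)` in the sense of
`Torus.IsWeakEulerSolutionOn` (an `L²_{t,x}` class tested against smooth divergence-free fields
compactly supported in time) which moreover lies in `L³((0,T) × T^d)`, and for the torus
mollifier `K = Torus.kernel ε`, `0 < ε ≤ 1/4`, the mollified kinetic energy
`t ↦ E(u(t) ⋆ K) = ½‖u(t) ⋆ K‖₂²` has distributional time derivative `Π_K[u(t)]` on `(0,T)`: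
`∫₀ᵀ θ'(t) E(u(t) ⋆ K) dt = -∫₀ᵀ θ(t) Π_K[u(t)] dt` for every smooth `θ` compactly supported in
`(0,T)`. (CCFS, §3.1, last paragraph, on admissibility of `ψ`: "By an approximation argument one
can show that for any weak solution `u` of the Euler equation, the relationship (7) holds for all
`ψ` that are smooth and localized in space, but only weakly Lipschitz in time. This justifies the
use of physical space mollifications of `u` as test functions `ψ`." In the present setting the
admissible test field is the space–time mollification `ρ_δ ∗ₜ (θ · (u ⋆ K) ⋆ K)`, `δ → 0`; the
hypothesis `u ∈ L³_{t,x}` makes `t ↦ Π_K[u(t)]` integrable.) [cite: CCFS2008, §3.2 eq. (11)] -/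
def _root_.Literature.Analysis.FunctionSpaces.Torus.IsWeakEulerSolutionOn.energyBalance_vecConv : Prop :=
  ∀ {T : ℝ} {u : ℝ → UnitAddTorus d → EuclideanSpace ℝ d} (hu : FunctionSpaces.Torus.IsWeakEulerSolutionOn T u)
    (hu3 : ∫⁻ t in Ioo 0 T, ∫⁻ x, ‖u t x‖ₑ ^ 3 < ⊤) {ε : ℝ} (hε : 0 < ε) (hε' : ε ≤ 1 / 4)
    {θ : ℝ → ℝ} (hθ : ContDiff ℝ ∞ θ) (hθc : HasCompactSupport θ) (hθT : tsupport θ ⊆ Ioo 0 T),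
    ∫ t in Ioo 0 T, deriv θ t * FunctionSpaces.Torus.kineticEnergy (vecConv (u t) (FunctionSpaces.Torus.kernel ε)) =
      -∫ t in Ioo 0 T, θ t * cetFlux (FunctionSpaces.Torus.kernel ε) (u t)

/-- **The Constantin–E–Titi flux estimate, local form** (Constantin–E–Titi 1994, (4)–(6);
Cheskidov–Constantin–Friedlander–Shvydkoy 2008, §3.2, (14)–(18), proof of Prop. 3.2: "Following
[cet] we write `S_Q(u ⊗ u) = r_Q(u,u) - (u - S_Q u) ⊗ (u - S_Q u) + S_Q u ⊗ S_Q u`, …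
`‖r_Q(u,u)‖_{3/2} ≤ ∫ |h̃_Q(y)| ‖u(· - y) - u(·)‖₃² dy`", Hölder `3/2 · 3`, and the
divergence-free cancellation `∫ tr[S_Q u ⊗ S_Q u · ∇S_Q u] = 0`). Mollifier transcription on
`T^d`: there is a constant `C` (depending only on `d` and the fixed profile of `Torus.kernel`)
such that for every `v ∈ L³(T^d; ℝ^d)` which is weakly divergence free and every
`0 < ε ≤ 1/4`,
`|Π_{K_ε}[v]| ≤ C · ω(v; ε)³`, where `ω(v; ε) = sup_{0 < ‖y‖ ≤ ε} ‖v(· + y) - v‖₃ / ‖y‖^{1/3}`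
is the local difference modulus `eLocDiffModulus (1/3) 3 v volume ε`: indeed `K_ε` and `∇K_ε`
are supported in `{‖y‖ ≤ ε}`, `∫ K_ε = 1`, `∫ ‖∇K_ε‖ = C₁/ε`
(`Torus.integral_norm_gradient_kernel`), so that `‖r‖_{3/2}, ‖v - v ⋆ K_ε‖₃² ≤ (ε^{1/3} ω)²`
and `‖∇(v ⋆ K_ε)‖₃ ≤ (C₁/ε) ε^{1/3} ω`. Stated in `ℝ≥0∞` (the modulus is an extended
supremum). [cite: CCFS2008, §3.2 (14)–(18)] -/
def abs_cetFlux_le_eLocDiffModulus : Prop :=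
  ∃ C : ℝ≥0, ∀ {v : UnitAddTorus d → EuclideanSpace ℝ d} (hv : MemLp v 3 volume)
    (hdiv : FunctionSpaces.Torus.IsWeaklyDivFree v) {ε : ℝ} (hε : 0 < ε) (hε' : ε ≤ 1 / 4),
    ENNReal.ofReal |cetFlux (FunctionSpaces.Torus.kernel ε) v| ≤ C * eLocDiffModulus (1 / 3) 3 v volume ε ^ 3

/-- **The total flux vanishes in the CCFS class** (Cheskidov–Constantin–Friedlander–Shvydkoy
2008, (13) and Thm 3.3: "`limsup_{Q → ∞} |Π_Q| ≤ limsup_{Q → ∞} d_Q³` … The total energy flux of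
any divergence-free vector field in the class `B^{1/3}_{3,c(ℕ)} ∩ L²` vanishes. In particular,
every weak solution to the Euler equation that belongs to the class `L³([0,T]; B^{1/3}_{3,c(ℕ)})
∩ C_w([0,T]; L²)` conserves energy", the passage from the first to the second sentence being
dominated convergence in time). Mollifier/difference-quotient transcription on `T^d`: for a
jointly measurable `u` on `(0,T) × T^d`, weakly divergence free at a.e. time, of class
`L³(0,T; B^{1/3}_{3,c₀}(T^d))` (`Literature.MemLpBesovSupVanishing 3 (1/3) 3`), the time-integrated flux
through the mollifier scale `ε` tends to zero: `∫₀ᵀ |Π_{K_ε}[u(t)]| dt → 0` as `ε → 0⁺`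
(from `abs_cetFlux_le_eLocDiffModulus`: `|Π_{K_ε}[u(t)]| ≤ C ω(u(t); ε)³ → 0` for a.e. `t`
(`MemBesovSupVanishing.tendsto_eLocDiffModulus`), dominated by `C [u(t)]³_{B^{1/3}_{3,∞}} ∈ L¹(0,T)`).
Lower Lebesgue integral in time (no integrability is presupposed). [cite: CCFS2008, Thm 3.3 and (13)] -/
def tendsto_lintegral_cetFlux : Prop :=
  ∀ {T : ℝ} {u : ℝ → UnitAddTorus d → EuclideanSpace ℝ d}
    (hm : AEStronglyMeasurable (FunctionSpaces.Torus.stLift u) (volume.restrict (Ioo 0 T ×ˢ univ)))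
    (hdiv : ∀ᵐ t ∂(volume.restrict (Ioo 0 T)), FunctionSpaces.Torus.IsWeaklyDivFree (u t))
    (hB : FunctionSpaces.MemLpBesovSupVanishing 3 (1 / 3) 3 u volume (Ioo 0 T)),
    Tendsto (fun ε : ℝ => ∫⁻ t in Ioo 0 T, ‖cetFlux (FunctionSpaces.Torus.kernel ε) (u t)‖ₑ) (𝓝[>] 0) (𝓝 0)

/-- **The mollified kinetic energy converges in `L¹(0,T)`** (Evans, *PDE*, App. C.4, Thm 7 (iv):
`f^ε → f` in `L^p_{loc}`; here `p = 2` slice-wise on `T^d`, `Torus.tendsto_eLpNorm_convolution_sub_self`,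
integrated in time by dominated convergence with the bound `E(u(t) ⋆ K_ε) ≤ E(u(t))` from
Young's inequality): for a jointly measurable `u ∈ L²((0,T) × T^d)`,
`∫₀ᵀ |E(u(t) ⋆ K_ε) - E(u(t))| dt → 0` as `ε → 0⁺`. This is the (implicit) last step of the
proof of CCFS 2008, Thm 3.3 (`‖S_Q u(t)‖₂ → ‖u(t)‖₂`). Lower Lebesgue integral in time. [cite: Evans2010, App. C.4 Thm 7 (iv)] -/
def tendsto_lintegral_kineticEnergy_vecConv_sub : Prop :=
  ∀ {T : ℝ} {u : ℝ → UnitAddTorus d → EuclideanSpace ℝ d}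
    (hm : AEStronglyMeasurable (FunctionSpaces.Torus.stLift u) (volume.restrict (Ioo 0 T ×ˢ univ)))
    (hu2 : ∫⁻ t in Ioo 0 T, ∫⁻ x, ‖u t x‖ₑ ^ 2 < ⊤),
    Tendsto (fun ε : ℝ => ∫⁻ t in Ioo 0 T,
      ‖FunctionSpaces.Torus.kineticEnergy (vecConv (u t) (FunctionSpaces.Torus.kernel ε)) - FunctionSpaces.Torus.kineticEnergy (u t)‖ₑ) (𝓝[>] 0) (𝓝 0)

end Facts

/-! ## Measure-theoretic glue (proved) -/

section Glue

variable {F' : Type*} [NormedAddCommGroup F']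

omit [DecidableEq d] in
/-- **`L³_t B^{s}_{3,∞} ⊂ L³_{t,x}`.** A field of class `MemLpBesovSup 3 s 3` on the time set `S`
has `∫_S ∫ ‖u‖³ < ∞`: slice-wise `‖u(t)‖_{L³} ≤ ‖u(t)‖_{B^s_{3,∞}}` (the Besov norm contains the
`L³` norm, `Literature.Analysis.FunctionSpaces.eBesovSupNorm`), cubed and integrated in time against the finiteness of
`Literature.Analysis.FunctionSpaces.eLpBesovSupNorm`. Only lower Lebesgue integrals and a.e. inequalities are used, so no
measurability in time of the Besov norm is needed. [folklore] -/
theorem lintegral_lintegral_enorm_pow_three_lt_top_of_memLpBesovSup {G : Type*}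
    [NormedAddCommGroup G] [MeasurableSpace G] {μ : Measure G} {s : ℝ} {S : Set ℝ}
    {u : ℝ → G → F'} (hB : FunctionSpaces.MemLpBesovSup 3 s 3 u μ S) :
    ∫⁻ t in S, ∫⁻ x, ‖u t x‖ₑ ^ 3 ∂μ < ⊤ := by
  have h3 : ((3 : ℝ≥0∞)).toReal = 3 := by norm_num
  have h2 : ∫⁻ t in S, ‖(FunctionSpaces.eBesovSupNorm s 3 (u t) μ).toReal‖ₑ ^ (3 : ℝ) < ⊤ := by
    have := lintegral_rpow_enorm_lt_top_of_eLpNorm_lt_top (by norm_num) (by norm_num) hB.2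
    rwa [h3] at this
  refine lt_of_le_of_lt (lintegral_mono_ae ?_) h2
  filter_upwards [hB.1] with t ht
  have hfin : FunctionSpaces.eBesovSupNorm s 3 (u t) μ ≠ ⊤ := ht.eBesovSupNorm_lt_top.ne
  have hpow : ∫⁻ x, ‖u t x‖ₑ ^ 3 ∂μ = eLpNorm (u t) 3 μ ^ (3 : ℝ) := by
    have h := lintegral_rpow_enorm_eq_rpow_eLpNorm' (f := u t) (μ := μ) (q := 3)
      (by norm_num : (0 : ℝ) < 3)
    rw [eLpNorm_eq_eLpNorm' (by norm_num) (by norm_num), h3, ← h]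
    refine lintegral_congr fun x => ?_
    rw [show (3 : ℝ) = ((3 : ℕ) : ℝ) by norm_num, ENNReal.rpow_natCast]
  rw [hpow, Real.enorm_eq_ofReal ENNReal.toReal_nonneg, ENNReal.ofReal_toReal hfin]
  exact ENNReal.rpow_le_rpow le_self_add (by norm_num)

omit [DecidableEq d] in
/-- **The kinetic energy of an `L²_{t,x}` field is integrable in time.** For `u` jointly
measurable on `S × T^d` with `∫_S ∫ ‖u‖² < ∞`, `t ↦ E(u(t)) = ½ ∫ ‖u(t,x)‖² dx` is integrable
on `S` (measurable by Fubini, Mathlib's `AEStronglyMeasurable.integral_prod_right'`; bounded by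
`E(u(t)) ≤ ∫⁻ ‖u(t)‖ₑ²`, Mathlib's `ofReal_integral_le_lintegral_ofReal`, which needs no
integrability of the slice). [folklore] -/
theorem integrableOn_kineticEnergy {S : Set ℝ} {u : ℝ → UnitAddTorus d → EuclideanSpace ℝ d}
    (hm : AEStronglyMeasurable (uncurry u) ((volume.restrict S).prod volume))
    (h2 : ∫⁻ t in S, ∫⁻ x, ‖u t x‖ₑ ^ 2 < ⊤) :
    IntegrableOn (fun t => FunctionSpaces.Torus.kineticEnergy (u t)) S := by
  have hmeas : AEStronglyMeasurable (fun t => FunctionSpaces.Torus.kineticEnergy (u t)) (volume.restrict S) := by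
    have h := ((continuous_pow 2).comp_aestronglyMeasurable hm.norm).integral_prod_right'
    exact h.const_mul 2⁻¹
  refine ⟨hmeas, ?_⟩
  refine lt_of_le_of_lt (lintegral_mono fun t => ?_) h2
  have hE : 0 ≤ FunctionSpaces.Torus.kineticEnergy (u t) := FunctionSpaces.Torus.kineticEnergy_nonneg _
  have hI : 0 ≤ ∫ x, ‖u t x‖ ^ 2 := integral_nonneg fun _ => sq_nonneg _
  rw [Real.enorm_eq_ofReal hE]
  calc ENNReal.ofReal (FunctionSpaces.Torus.kineticEnergy (u t))
      ≤ ENNReal.ofReal (∫ x, ‖u t x‖ ^ 2) := by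
        refine ENNReal.ofReal_le_ofReal ?_
        unfold FunctionSpaces.Torus.kineticEnergy
        nlinarith
    _ = ‖∫ x, ‖u t x‖ ^ 2‖ₑ := (Real.enorm_eq_ofReal hI).symm
    _ ≤ ∫⁻ x, ‖‖u t x‖ ^ 2‖ₑ := enorm_integral_le_lintegral_enorm _
    _ = ∫⁻ x, ‖u t x‖ₑ ^ 2 := lintegral_congr fun x => by
        rw [Real.enorm_eq_ofReal (sq_nonneg _), ENNReal.ofReal_pow (norm_nonneg _), ofReal_norm]

omit [DecidableEq d] in
/-- Components of a jointly measurable vector field are jointly measurable. [folklore] -/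
theorem aestronglyMeasurable_uncurry_apply {α : Type*} [MeasurableSpace α] {μ : Measure α}
    {u : α → UnitAddTorus d → EuclideanSpace ℝ d}
    (hm : AEStronglyMeasurable (uncurry u) (μ.prod volume)) (i : d) :
    AEStronglyMeasurable (uncurry fun a y => u a y i) (μ.prod volume) :=
  (EuclideanSpace.proj (𝕜 := ℝ) i).continuous.comp_aestronglyMeasurable hm

omit [DecidableEq d] in
/-- **Mollified fields are jointly measurable**: for `u` jointly measurable on `α × T^d` and a
continuous kernel `K`, `(a, x) ↦ (u(a) ⋆ K)(x)` (componentwise mollification, `vecConv`) is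
jointly measurable (`Torus.aestronglyMeasurable_uncurry_convolution` componentwise, reassembled
through the measurable map `WithLp.toLp`). [folklore] -/
theorem aestronglyMeasurable_uncurry_vecConv {α : Type*} [MeasurableSpace α] {μ : Measure α}
    [SFinite μ] {u : α → UnitAddTorus d → EuclideanSpace ℝ d}
    (hm : AEStronglyMeasurable (uncurry u) (μ.prod volume)) {K : UnitAddTorus d → ℝ}
    (hK : Continuous K) :
    AEStronglyMeasurable (uncurry fun a x => vecConv (u a) K x) (μ.prod volume) := by
  have hc : ∀ i, AEStronglyMeasurable (uncurry fun a x => ((fun y => u a y i) ⋆ K) x)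
      (μ.prod volume) := fun i =>
    FunctionSpaces.Torus.aestronglyMeasurable_uncurry_convolution (ContinuousLinearMap.lsmul ℝ ℝ) (aestronglyMeasurable_uncurry_apply hm i) hK
  have hpi : AEMeasurable (fun z : α × UnitAddTorus d => fun i => ((fun y => u z.1 y i) ⋆ K) z.2)
      (μ.prod volume) :=
    aemeasurable_pi_lambda _ fun i => (hc i).aemeasurable
  exact ((WithLp.measurable_toLp 2 (d → ℝ)).comp_aemeasurable hpi).aestronglyMeasurable

omit [DecidableEq d] in
/-- The mollified kinetic energy `t ↦ E(u(t) ⋆ K)` is a.e.-strongly measurable in time for a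
jointly measurable `u` and a continuous kernel `K`. [folklore] -/
theorem aestronglyMeasurable_kineticEnergy_vecConv {S : Set ℝ}
    {u : ℝ → UnitAddTorus d → EuclideanSpace ℝ d}
    (hm : AEStronglyMeasurable (uncurry u) ((volume.restrict S).prod volume))
    {K : UnitAddTorus d → ℝ} (hK : Continuous K) :
    AEStronglyMeasurable (fun t => FunctionSpaces.Torus.kineticEnergy (vecConv (u t) K)) (volume.restrict S) := by
  have h := ((continuous_pow 2).comp_aestronglyMeasurable
    (aestronglyMeasurable_uncurry_vecConv hm hK).norm).integral_prod_right'
  exact h.const_mul 2⁻¹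

omit [Fintype d] [DecidableEq d] in
/-- From the space–time-lift measurability recorded in the solution classes to product
measurability on `S × T^d`. [folklore] -/
theorem aestronglyMeasurable_uncurry_restrict_prod_of_stLift [Fintype d] {S : Set ℝ}
    {u : ℝ → UnitAddTorus d → F'}
    (hu : AEStronglyMeasurable (FunctionSpaces.Torus.stLift u) (volume.restrict (S ×ˢ univ))) :
    AEStronglyMeasurable (uncurry u) ((volume.restrict S).prod volume) := by
  have h := FunctionSpaces.Torus.aestronglyMeasurable_uncurry_of_stLift_restrict hu
  rwa [Measure.volume_eq_prod, ← Measure.prod_restrict, Measure.restrict_univ] at h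

end Glue

end Torus

/-! ## The energy is distributionally constant (assembly of the named facts) -/

section Turb

open FunctionSpaces.Torus Torus

/-- `‖θ(t) x‖ₑ ≤ A ‖x‖ₑ` when `|θ| ≤ A` (used to take bounded test functions out of lower
Lebesgue integrals). [folklore] -/
theorem enorm_mul_le_ofReal_mul {θ : ℝ → ℝ} {A : ℝ} (hA : ∀ t, |θ t| ≤ A) (t : ℝ) (x : ℝ) :
    ‖θ t * x‖ₑ ≤ ENNReal.ofReal A * ‖x‖ₑ := by
  rw [enorm_mul]
  refine mul_le_mul_left ?_ _
  rw [Real.enorm_eq_ofReal_abs]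
  exact ENNReal.ofReal_le_ofReal (hA t)

/-- **Energy is distributionally constant.** Under the named facts, for a weak Euler solution
`u` on `T³ × (0,T)` of class `L³_t B^{1/3}_{3,c₀}` and every smooth `θ` compactly supported in
`(0,T)`: `∫₀ᵀ θ'(t) E(u(t)) dt = 0` — the limit `ε → 0⁺` of the mollified energy balance
`∫ θ' E(u ⋆ K_ε) = -∫ θ Π_{K_ε}[u]` (CCFS 2008, proof of Thm 3.3: (11) integrated against `θ`,
then (13) and `‖S_Q u(t)‖₂ → ‖u(t)‖₂`). [cite: CCFS2008, Thm 3.3] -/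
theorem setIntegral_deriv_mul_energyProfile_eq_zero
    (h1 : IsWeakEulerSolutionOn.energyBalance_vecConv (d := Fin 3))
    (h3 : tendsto_lintegral_cetFlux (d := Fin 3))
    (h4 : tendsto_lintegral_kineticEnergy_vecConv_sub (d := Fin 3))
    {T : ℝ} {u : ℝ → UnitAddTorus (Fin 3) → EuclideanSpace ℝ (Fin 3)} (hu : IsWeakEulerSolution T u)
    (hB : MemL3tBesovThirdVanishing T u) {θ : ℝ → ℝ} (hθ : ContDiff ℝ ∞ θ)
    (hθc : HasCompactSupport θ) (hθT : tsupport θ ⊆ Ioo 0 T) :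
    ∫ t in Ioo 0 T, deriv θ t * energyProfile u t = 0 := by
  -- unpack the weak solution and the Besov class
  have hm : AEStronglyMeasurable (stLift u) (volume.restrict (Ioo 0 T ×ˢ univ)) := hu.1
  have hL2 : ∫⁻ t in Ioo 0 T, ∫⁻ x, ‖u t x‖ₑ ^ 2 < ⊤ := hu.2.1
  have hdiv : ∀ᵐ t ∂(volume.restrict (Ioo 0 T)), IsWeaklyDivFree (u t) := hu.2.2.1
  have hm' : AEStronglyMeasurable (uncurry u) ((volume.restrict (Ioo 0 T)).prod volume) :=
    aestronglyMeasurable_uncurry_restrict_prod_of_stLift hm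
  have hL3 : ∫⁻ t in Ioo 0 T, ∫⁻ x, ‖u t x‖ₑ ^ 3 < ⊤ :=
    lintegral_lintegral_enorm_pow_three_lt_top_of_memLpBesovSup hB.memLpBesovSup
  have he : IntegrableOn (fun t => energyProfile u t) (Ioo 0 T) :=
    integrableOn_kineticEnergy hm' hL2
  -- bounds for `θ` and `θ'`
  obtain ⟨A, hA⟩ := FunctionSpaces.exists_forall_abs_le_of_hasCompactSupport hθ.continuous hθc
  have hθ'c : Continuous (deriv θ) := hθ.continuous_deriv (by simp)
  obtain ⟨A', hA'⟩ := FunctionSpaces.exists_forall_abs_le_of_hasCompactSupport hθ'c hθc.deriv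
  -- the mollified energies and the tested mollified energy
  set I : ℝ := ∫ t in Ioo 0 T, deriv θ t * energyProfile u t with hI
  let G : ℝ → ℝ := fun ε => ∫ t in Ioo 0 T, deriv θ t * kineticEnergy (vecConv (u t) (kernel ε))
  have hsmall : ∀ᶠ ε in 𝓝[>] (0 : ℝ), 0 < ε ∧ ε ≤ 1 / 4 := by
    filter_upwards [Ioc_mem_nhdsGT (show (0 : ℝ) < 1 / 4 by norm_num)] with ε hε
    exact ⟨hε.1, hε.2⟩
  -- (i) `G ε → 0`: by the mollified energy balance `G ε = -∫ θ Π_ε`, and the flux vanishes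
  have hG0 : Tendsto G (𝓝[>] 0) (𝓝 0) := by
    have hb : Tendsto (fun ε : ℝ => (ENNReal.ofReal A *
        ∫⁻ t in Ioo 0 T, ‖cetFlux (kernel ε) (u t)‖ₑ).toReal) (𝓝[>] 0) (𝓝 0) := by
      have h := ENNReal.Tendsto.const_mul (h3 hm hdiv hB) (Or.inr ENNReal.ofReal_ne_top)
        (a := ENNReal.ofReal A)
      rw [mul_zero] at h
      have h' := (ENNReal.tendsto_toReal ENNReal.zero_ne_top).comp h
      rwa [ENNReal.toReal_zero] at h'
    -- eventually the bound is finite (it tends to `0`), so `toReal` is monotone there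
    have hfin : ∀ᶠ ε in 𝓝[>] (0 : ℝ),
        ENNReal.ofReal A * ∫⁻ t in Ioo 0 T, ‖cetFlux (kernel ε) (u t)‖ₑ < ⊤ := by
      have h := ENNReal.Tendsto.const_mul (h3 hm hdiv hB) (Or.inr ENNReal.ofReal_ne_top)
        (a := ENNReal.ofReal A)
      rw [mul_zero] at h
      exact h.eventually (Iio_mem_nhds ENNReal.zero_lt_top)
    refine squeeze_zero_norm' ?_ hb
    filter_upwards [hsmall, hfin] with ε hε hεfin
    show ‖∫ t in Ioo 0 T, deriv θ t * kineticEnergy (vecConv (u t) (kernel ε))‖ ≤ _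
    rw [h1 hu hL3 hε.1 hε.2 hθ hθc hθT, norm_neg]
    refine (norm_integral_le_lintegral_norm _).trans (ENNReal.toReal_mono hεfin.ne ?_)
    rw [← lintegral_const_mul' _ _ ENNReal.ofReal_ne_top]
    refine lintegral_mono fun t => ?_
    rw [ofReal_norm]
    exact enorm_mul_le_ofReal_mul hA t _
  -- (ii) `G ε → I`: the mollified energies converge in `L¹(0,T)`
  have hGI : Tendsto G (𝓝[>] 0) (𝓝 I) := by
    have hlim := h4 hm hL2
    have hb : Tendsto (fun ε : ℝ => (ENNReal.ofReal A' * ∫⁻ t in Ioo 0 T,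
        ‖kineticEnergy (vecConv (u t) (kernel ε)) - kineticEnergy (u t)‖ₑ).toReal)
        (𝓝[>] 0) (𝓝 0) := by
      have h := ENNReal.Tendsto.const_mul hlim (Or.inr ENNReal.ofReal_ne_top)
        (a := ENNReal.ofReal A')
      rw [mul_zero] at h
      have h' := (ENNReal.tendsto_toReal ENNReal.zero_ne_top).comp h
      rwa [ENNReal.toReal_zero] at h'
    have hfin : ∀ᶠ ε in 𝓝[>] (0 : ℝ), ∫⁻ t in Ioo 0 T,
        ‖kineticEnergy (vecConv (u t) (kernel ε)) - kineticEnergy (u t)‖ₑ < ⊤ :=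
      hlim.eventually (Iio_mem_nhds ENNReal.zero_lt_top)
    rw [tendsto_iff_norm_sub_tendsto_zero]
    refine squeeze_zero' (Eventually.of_forall fun ε => norm_nonneg _) ?_ hb
    filter_upwards [hsmall, hfin] with ε hε hεfin
    -- integrability of the mollified energy at an admissible scale: it is measurable
    -- (`aestronglyMeasurable_kineticEnergy_vecConv`) and within finite `L¹` distance of `e`
    have hmeasE : AEStronglyMeasurable (fun t => kineticEnergy (vecConv (u t) (kernel ε)))
        (volume.restrict (Ioo 0 T)) :=
      aestronglyMeasurable_kineticEnergy_vecConv hm' (continuous_kernel hε.1 hε.2)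
    have hdiff : IntegrableOn
        (fun t => kineticEnergy (vecConv (u t) (kernel ε)) - kineticEnergy (u t)) (Ioo 0 T) :=
      ⟨hmeasE.sub he.aestronglyMeasurable, hεfin⟩
    have hEint : IntegrableOn (fun t => kineticEnergy (vecConv (u t) (kernel ε))) (Ioo 0 T) := by
      have h := hdiff.add he
      refine h.congr_fun (fun t _ => ?_) measurableSet_Ioo
      simp only [energyProfile, Pi.add_apply, sub_add_cancel]
    have i1 : IntegrableOn (fun t => deriv θ t * kineticEnergy (vecConv (u t) (kernel ε)))
        (Ioo 0 T) :=
      FunctionSpaces.integrableOn_continuous_mul_of_hasCompactSupport hEint hθ'c hθc.deriv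
    have i2 : IntegrableOn (fun t => deriv θ t * energyProfile u t) (Ioo 0 T) :=
      FunctionSpaces.integrableOn_continuous_mul_of_hasCompactSupport he hθ'c hθc.deriv
    show ‖(∫ t in Ioo 0 T, deriv θ t * kineticEnergy (vecConv (u t) (kernel ε))) - I‖ ≤ _
    rw [hI, ← integral_sub i1 i2]
    refine (norm_integral_le_lintegral_norm _).trans
      (ENNReal.toReal_mono (ENNReal.mul_ne_top ENNReal.ofReal_ne_top hεfin.ne) ?_)
    rw [← lintegral_const_mul' _ _ ENNReal.ofReal_ne_top]
    refine lintegral_mono fun t => ?_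
    rw [ofReal_norm, ← mul_sub]
    exact enorm_mul_le_ofReal_mul hA' t _
  exact tendsto_nhds_unique hGI hG0

end Turb

end Literature.Analysis.FluidPDE
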